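import Literature.MathematicalPhysics.QuantumManyBody.OnsagerInequality
import Literature.MathematicalPhysics.QuantumManyBody.JelliumBoseGasProofs
import HarnessLib

/-!
# The Onsager–Lieb–Narnhofer lower bound for jellium: `U ≥ -(3/2) N ρ^{1/3}`

Topic `Literature/MathematicalPhysics/QuantumManyBody` (groundwork for the charged Bose gas,
`JelliumBoseGas.foldyLaw` [LSSY2005, Thm. 10.1]). "One way to get an excessively negative lower
bound to `e₀` for jellium is to ignore the kinetic energy. One can then show easily (by an argument
due to Onsager) that the potential energy alone is bounded below by `e₀ ∼ -ρ^{1/3}`. See [LN]."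
[LiebSolovej2001, p. 5]; [LiebSeiringer2009, §14.7] (smearing over balls, Newton's theorem:
`-0.9 (4π/3)^{1/3} N ρ^{1/3} ≈ -1.45 N ρ^{1/3}`). Here the argument is carried out with GAUSSIAN
clouds (`OnsagerInequality.lean`), where everything is explicit, with the constant `3/2`:
for distinct `x₁, …, x_N ∈ ℝ³`, a box `Λ_L` and background density `ρ ≥ 0`,

`U(X) = ∑_{i<j} |xᵢ - xⱼ|⁻¹ - ρ ∑ᵢ ∫_Λ |xᵢ - y|⁻¹ dy + ½ρ² ∬_{Λ×Λ} |x - y|⁻¹ ≥ -N (4πρt + (2√(2πt))⁻¹)`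

for every `t > 0` (Onsager's lemma with the clouds `G_t(· - xᵢ)` and the background `ρ𝟙_Λ`, plus
`∑ᵢ ∫ ρ𝟙_Λ ((4π|xᵢ - y|)⁻¹ - V_t(xᵢ - y)) dy ≤ N ρ t` from the defect mass
`∫ ((4π|z|)⁻¹ - V_t(z)) dz = t`), and the optimal `t = (8π ρ^{2/3})⁻¹` gives **`U ≥ -(3/2) N ρ^{1/3}`**.
Consequently, in the tree's `ℝ≥0∞` vocabulary (`JelliumBoseGas.lean`), for every trial state and
every repulsive core `v`, `chargedEnergy v q ρ Ψ ≥ jelliumEnergyShift q ρ N L - (3/2) q N ρ^{1/3}`,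
and the neutral-jellium ground-state energy per particle in the normalisation of `foldyLaw` obeys
the a priori bound **`E₀(N, L)/N ≥ -(3/2) q ρ^{1/3}`** for all `N ≥ 1`, `L > 0` — to be compared with
Foldy's `-0.48 q^{5/4} ρ^{1/4}` at high density.

* `JelliumBoseGas.integrable_mul_coulomb_of_bounded` — `y ↦ ρ(y)(4π|x - y|)⁻¹ ∈ L¹` for bounded
  `ρ ∈ L¹(ℝ³)`.
* `JelliumBoseGas.integral_coulomb_le_cloud_add`, `sum_integral_coulomb_le_cloud_add` — for
  `0 ≤ ρ ≤ ρ̄`: `∫ ρ(y)(4π|x - y|)⁻¹ dy ≤ ∫ ρ(y) V_t(x - y) dy + ρ̄ t`.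
* `JelliumBoseGas.volume_setOf_apply_eq`, `ae_injective` — coincident configurations are null.
* `JelliumBoseGas.integral_boxBackground_mul_coulomb`, `integral_prod_boxBackground_coulomb` — the
  box background `ρ̄𝟙_Λ`: potential `(4π)⁻¹ ρ̄ V₁(x)` and Coulomb energy
  `(4π)⁻¹ · 2 · backgroundSelfEnergy ρ̄ L` (finite).
* `JelliumBoseGas.coulombEnergy_ge_of_clouds` — `U ≥ -N(4πρ̄t + (2√(2πt))⁻¹)` for all `t > 0`;
  `JelliumBoseGas.coulombEnergy_ge` — **`U ≥ -(3/2) N ρ̄^{1/3}`**.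
* `JelliumBoseGas.jelliumInteraction_ge`, `lintegral_jelliumInteraction_ge`, `chargedEnergy_ge`,
  `chargedGroundStateEnergy_ge` — the bound transported to the tree's functional;
  `JelliumBoseGas.groundStateEnergy_per_particle_ge(_sideLength)` — **`E₀(N, L)/N ≥ -(3/2) q ρ^{1/3}`**.

## References

* [LiebSeiringer2009] E. H. Lieb, R. Seiringer, *The Stability of Matter in Quantum Mechanics*,
  Cambridge Univ. Press (2010), Lemma 6.1 (Onsager's lemma); §14.7 (jellium, the bound
  `-0.9 α N (4πρ/3)^{1/3}`, p. 230 of the held copy).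
* [LiebNarnhofer1975] E. H. Lieb, H. Narnhofer, J. Stat. Phys. 12 (1975) 291–310.
* [LiebSolovej2001] E. H. Lieb, J. P. Solovej, Commun. Math. Phys. 217 (2001) 127–163, p. 5
  (arXiv:cond-mat/0007425).
* [LSSY2005] E. H. Lieb, R. Seiringer, J. P. Solovej, J. Yngvason, *The Mathematics of the Bose
  Gas and its Condensation* (2005), Ch. 10 (10.1), Thm. 10.1.
* [Onsager1939] L. Onsager, J. Phys. Chem. 43 (1939) 189–196.
-/

noncomputable section

open MeasureTheory Set Filter Real Metric
open scoped ENNReal NNReal Topology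
open Literature.Analysis.UnboundedOperators

namespace Literature.MathematicalPhysics.QuantumManyBody.JelliumBoseGas

open BoseGas Coulomb

/-! ### Bounded backgrounds: the Coulomb defect costs at most `ρ̄ t` per particle -/

/-- For a bounded `ρ ∈ L¹(ℝ³)` and every centre `x`, `y ↦ ρ(y) (4π|x - y|)⁻¹` is integrable
(local integrability of the Coulomb singularity near `x`, boundedness of the kernel away from it).
[folklore] -/
theorem integrable_mul_coulomb_of_bounded {ρ : Space → ℝ} (hρm : AEStronglyMeasurable ρ volume)
    (hρ : Integrable ρ) {C : ℝ} (hC : ∀ y, |ρ y| ≤ C) (x : Space) :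
    Integrable fun y : Space => ρ y * (4 * π * ‖x - y‖)⁻¹ := by
  have hKm : AEStronglyMeasurable (fun y : Space => ρ y * (4 * π * ‖x - y‖)⁻¹) volume :=
    hρm.mul ((measurable_const.mul (measurable_const.sub measurable_id).norm).inv).aestronglyMeasurable
  have h1 : IntegrableOn (fun y : Space => ρ y * (4 * π * ‖x - y‖)⁻¹) (ball x 1) := by
    refine Integrable.mono' ((integrableOn_inv_norm_sub_ball x 1).const_mul (C * (4 * π)⁻¹))
      hKm.restrict ?_
    refine (ae_restrict_iff' measurableSet_ball).2 (Eventually.of_forall fun y _ => ?_)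
    rw [Real.norm_eq_abs, abs_mul,
      abs_of_nonneg (inv_nonneg.2 (by positivity) : (0 : ℝ) ≤ (4 * π * ‖x - y‖)⁻¹), mul_inv]
    calc |ρ y| * ((4 * π)⁻¹ * ‖x - y‖⁻¹) ≤ C * ((4 * π)⁻¹ * ‖x - y‖⁻¹) :=
          mul_le_mul_of_nonneg_right (hC y) (by positivity)
      _ = C * (4 * π)⁻¹ * ‖x - y‖⁻¹ := by ring
  have h2 : IntegrableOn (fun y : Space => ρ y * (4 * π * ‖x - y‖)⁻¹) (ball x 1)ᶜ := by
    refine Integrable.mono' (hρ.norm.mul_const (4 * π)⁻¹).integrableOn hKm.restrict ?_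
    refine (ae_restrict_iff' measurableSet_ball.compl).2 (Eventually.of_forall fun y hy => ?_)
    have hy1 : 1 ≤ ‖x - y‖ := by
      rw [mem_compl_iff, mem_ball, dist_eq_norm, not_lt, norm_sub_rev] at hy
      exact hy
    rw [norm_mul, Real.norm_of_nonneg (inv_nonneg.2 (by positivity) : (0 : ℝ) ≤ (4 * π * ‖x - y‖)⁻¹)]
    refine mul_le_mul_of_nonneg_left ?_ (norm_nonneg _)
    exact inv_anti₀ (by positivity) (le_mul_of_one_le_right (by positivity) hy1)
  have h := h1.union h2
  rwa [union_compl_self, integrableOn_univ] at h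

/-- The Coulomb defect of a cloud is even: `∫₀^t G_u(-z) du = ∫₀^t G_u(z) du`. [folklore] -/
theorem cloudDefect_neg (t : ℝ) (z : Space) :
    ∫ u in Ioc 0 t, heatKernel u (-z) = ∫ u in Ioc 0 t, heatKernel u z := by
  simp_rw [heatKernel_neg]

/-- **The Coulomb defect costs at most `ρ̄ t`**: for `t > 0` and a measurable background
`0 ≤ ρ ≤ ρ̄` in `L¹(ℝ³)`, at every point `x`,
`∫ ρ(y) (4π|x - y|)⁻¹ dy ≤ ∫ ρ(y) V_t(x - y) dy + ρ̄ t`, `V_t(z) = ∫_t^∞ G_u(z) du`: the difference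
is `∫ ρ(y) (∫₀^t G_u(x - y) du) dy ≤ ρ̄ ∫ (∫₀^t G_u) = ρ̄ t` (`Coulomb.integral_cloudDefect`).
[cite: LiebSeiringer2009, §14.7] -/
theorem integral_coulomb_le_cloud_add {t : ℝ} (ht : 0 < t) {ρ : Space → ℝ} (hρm : Measurable ρ)
    (hρ : Integrable ρ) {ρbar : ℝ} (h0 : ∀ y, 0 ≤ ρ y) (h1 : ∀ y, ρ y ≤ ρbar) (x : Space) :
    ∫ y, ρ y * (4 * π * ‖x - y‖)⁻¹ ≤ (∫ y, ρ y * ∫ u in Ioi t, heatKernel u (x - y)) + ρbar * t := by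
  have hC : ∀ y, |ρ y| ≤ ρbar := fun y => by rw [abs_of_nonneg (h0 y)]; exact h1 y
  have hK := integrable_mul_coulomb_of_bounded hρm.aestronglyMeasurable hρ hC x
  have hVm : Measurable fun y : Space => ∫ u in Ioi t, heatKernel u (x - y) :=
    (measurable_cloudPotential t).comp (measurable_const.sub measurable_id)
  have hV : Integrable fun y : Space => ρ y * ∫ u in Ioi t, heatKernel u (x - y) := by
    refine hρ.mul_bdd (c := (4 * π * Real.sqrt (π * t))⁻¹) hVm.aestronglyMeasurable
      (Eventually.of_forall fun y => ?_)
    rw [Real.norm_of_nonneg (cloudPotential_nonneg ht.le _)]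
    exact cloudPotential_le_self ht _
  have hD : Integrable fun y : Space => ρbar * ∫ u in Ioc 0 t, heatKernel u (y - x) :=
    ((integrable_cloudDefect t).comp_sub_right x).const_mul ρbar
  have hae : ∀ᵐ y : Space ∂volume, y ≠ x := by
    have : (volume : Measure Space) {y | ¬y ≠ x} = 0 := by
      simp only [ne_eq, not_not, setOf_eq_eq_singleton, measure_singleton]
    exact ae_iff.2 this
  have hdiff : (∫ y, ρ y * (4 * π * ‖x - y‖)⁻¹) - ∫ y, ρ y * ∫ u in Ioi t, heatKernel u (x - y) =
      ∫ y, ρ y * ∫ u in Ioc 0 t, heatKernel u (y - x) := by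
    rw [← integral_sub hK hV]
    refine integral_congr_ae ?_
    filter_upwards [hae] with y hy
    rw [← mul_sub, coulomb_sub_cloudPotential ht (sub_ne_zero.2 (Ne.symm hy)), ← neg_sub y x,
      cloudDefect_neg]
  have hle : ∫ y, ρ y * ∫ u in Ioc 0 t, heatKernel u (y - x) ≤
      ∫ y, ρbar * ∫ u in Ioc 0 t, heatKernel u (y - x) := by
    refine integral_mono_of_nonneg ?_ hD ?_
    · exact Eventually.of_forall fun y => mul_nonneg (h0 y)
        (setIntegral_nonneg measurableSet_Ioc fun u hu => (heatKernel_pos hu.1 _).le)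
    · exact Eventually.of_forall fun y => mul_le_mul_of_nonneg_right (h1 y)
        (setIntegral_nonneg measurableSet_Ioc fun u hu => (heatKernel_pos hu.1 _).le)
  have hval : ∫ y, ρbar * ∫ u in Ioc 0 t, heatKernel u (y - x) = ρbar * t := by
    rw [integral_const_mul, integral_sub_right_eq_self (μ := (volume : Measure Space))
      (fun z : Space => ∫ u in Ioc 0 t, heatKernel u z) x, integral_cloudDefect ht]
  linarith

/-- Summed over the particles: `∑ᵢ ∫ ρ(y)(4π|xᵢ - y|)⁻¹ dy ≤ ∑ᵢ ∫ ρ(y) V_t(xᵢ - y) dy + N ρ̄ t`.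
[cite: LiebSeiringer2009, §14.7] -/
theorem sum_integral_coulomb_le_cloud_add {N : ℕ} (X : Fin N → Space) {t : ℝ} (ht : 0 < t)
    {ρ : Space → ℝ} (hρm : Measurable ρ) (hρ : Integrable ρ) {ρbar : ℝ} (h0 : ∀ y, 0 ≤ ρ y)
    (h1 : ∀ y, ρ y ≤ ρbar) :
    ∑ i, ∫ y, ρ y * (4 * π * ‖X i - y‖)⁻¹ ≤
      (∑ i, ∫ y, ρ y * ∫ u in Ioi t, heatKernel u (X i - y)) + N * (ρbar * t) := by
  have h := Finset.sum_le_sum fun i (_ : i ∈ Finset.univ) =>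
    integral_coulomb_le_cloud_add ht hρm hρ h0 h1 (X i)
  rw [Finset.sum_add_distrib, Finset.sum_const, Finset.card_univ, Fintype.card_fin,
    nsmul_eq_mul] at h
  exact h

/-! ### Coincident configurations are null -/

/-- For `i ≠ j` the coincidence set `{X | xᵢ = xⱼ} ⊂ (ℝ³)^N` is Lebesgue-null (a proper linear
subspace). [folklore] -/
theorem volume_setOf_apply_eq {N : ℕ} {i j : Fin N} (hij : i ≠ j) :
    volume {X : Config N | X i = X j} = 0 := by
  haveI : (volume : Measure (Config N)).IsAddHaarMeasure :=
    show Measure.IsAddHaarMeasure (Measure.pi fun _ : Fin N => (volume : Measure Space)) from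
      Measure.pi.isAddHaarMeasure _
  let f : Config N →ₗ[ℝ] Space :=
    LinearMap.proj (R := ℝ) (φ := fun _ : Fin N => Space) i -
      LinearMap.proj (R := ℝ) (φ := fun _ : Fin N => Space) j
  have hker : {X : Config N | X i = X j} = (LinearMap.ker f : Set (Config N)) := by
    ext X
    simp [f, sub_eq_zero]
  have hne : LinearMap.ker f ≠ ⊤ := by
    obtain ⟨v, hv⟩ := exists_ne (0 : Space)
    intro htop
    have hmem : (Pi.single i v : Config N) ∈ LinearMap.ker f := htop ▸ Submodule.mem_top
    rw [LinearMap.mem_ker] at hmem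
    simp [f, Pi.single_eq_of_ne hij.symm] at hmem
    exact hv hmem
  rw [hker]
  exact Measure.addHaar_submodule volume _ hne

/-- Almost every configuration has pairwise distinct particles. [folklore] -/
theorem ae_injective (N : ℕ) : ∀ᵐ X : Config N ∂volume, Function.Injective X := by
  have h : ∀ i j : Fin N, ∀ᵐ X : Config N ∂volume, X i = X j → i = j := by
    intro i j
    by_cases hij : i = j
    · exact Eventually.of_forall fun X _ => hij
    · rw [ae_iff]
      have : {X : Config N | ¬(X i = X j → i = j)} = {X | X i = X j} := by
        ext X
        simp [hij]
      rw [this]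
      exact volume_setOf_apply_eq hij
  filter_upwards [ae_all_iff.2 fun i => ae_all_iff.2 fun j => h i j] with X hX
  exact fun i j hij => hX i j hij

/-! ### The box background `ρ̄ 𝟙_Λ` -/

/-- The box `Λ_L` has finite volume (it lies in the ball of radius `3|L|`). [folklore] -/
theorem volume_box_lt_top (L : ℝ) : volume (box L) < ⊤ :=
  (measure_mono (fun _ hx => mem_closedBall_zero_iff.2 (norm_le_of_mem_box hx) :
    box L ⊆ closedBall (0 : Space) (3 * |L|))).trans_lt measure_closedBall_lt_top

/-- The box background is measurable. [folklore] -/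
theorem measurable_boxBackground (ρbar L : ℝ) :
    Measurable ((box L).indicator fun _ : Space => ρbar) :=
  measurable_const.indicator (measurableSet_box L)

/-- The box background is integrable. [folklore] -/
theorem integrable_boxBackground (ρbar L : ℝ) :
    Integrable ((box L).indicator fun _ : Space => ρbar) := by
  rw [integrable_indicator_iff (measurableSet_box L)]
  exact integrableOn_const (volume_box_lt_top L).ne

/-- **Potential of the box background**: `∫ ρ̄𝟙_Λ(y) (4π|x - y|)⁻¹ dy = (4π)⁻¹ ρ̄ V₁(x)`,
`V₁ = backgroundPotential L`. [cite: LSSY2005, Ch. 10 (10.1)] -/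
theorem integral_boxBackground_mul_coulomb (ρbar L : ℝ) (x : Space) :
    ∫ y, (box L).indicator (fun _ : Space => ρbar) y * (4 * π * ‖x - y‖)⁻¹ =
      (4 * π)⁻¹ * ρbar * backgroundPotential L x := by
  have h : (fun y => (box L).indicator (fun _ : Space => ρbar) y * (4 * π * ‖x - y‖)⁻¹) =
      (box L).indicator (fun y => (4 * π)⁻¹ * ρbar * ‖x - y‖⁻¹) := by
    funext y
    by_cases hy : y ∈ box L
    · rw [indicator_of_mem hy, indicator_of_mem hy, mul_inv]
      ring
    · rw [indicator_of_notMem hy, indicator_of_notMem hy, zero_mul]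
  rw [h, integral_indicator (measurableSet_box L), integral_const_mul, backgroundPotential]

/-- **Coulomb energy of the box background**: the Coulomb integrand of `ρ̄𝟙_Λ` is absolutely
integrable on `ℝ³ × ℝ³` and `∬ ρ̄𝟙_Λ(x) ρ̄𝟙_Λ(y) (4π|x - y|)⁻¹ = (4π)⁻¹ · 2 · backgroundSelfEnergy ρ̄ L`
(`= (4π)⁻¹ ρ̄² ∫_Λ V₁`, finite since `V₁ ≤ 6πL²` on `Λ`). [cite: LSSY2005, Ch. 10 (10.1)] -/
theorem integral_prod_boxBackground_coulomb (ρbar L : ℝ) :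
    Integrable (fun z : Space × Space => (box L).indicator (fun _ : Space => ρbar) z.1 *
        (box L).indicator (fun _ : Space => ρbar) z.2 * (4 * π * ‖z.1 - z.2‖)⁻¹)
        (volume.prod volume) ∧
      ∫ z : Space × Space, (box L).indicator (fun _ : Space => ρbar) z.1 *
          (box L).indicator (fun _ : Space => ρbar) z.2 * (4 * π * ‖z.1 - z.2‖)⁻¹
          ∂(volume.prod volume) = (4 * π)⁻¹ * (2 * backgroundSelfEnergy ρbar L) := by
  have hKm : Measurable fun z : Space × Space => (4 * π * ‖z.1 - z.2‖)⁻¹ :=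
    (measurable_const.mul (measurable_fst.sub measurable_snd).norm).inv
  have hs : MeasurableSet (box L ×ˢ box L) := (measurableSet_box L).prod (measurableSet_box L)
  -- the integrand is `ρ̄² K` restricted to `Λ × Λ`
  have hF : (fun z : Space × Space => (box L).indicator (fun _ : Space => ρbar) z.1 *
      (box L).indicator (fun _ : Space => ρbar) z.2 * (4 * π * ‖z.1 - z.2‖)⁻¹) =
      (box L ×ˢ box L).indicator fun z => ρbar ^ 2 * (4 * π * ‖z.1 - z.2‖)⁻¹ := by
    funext z
    by_cases h1 : z.1 ∈ box L
    · by_cases h2 : z.2 ∈ box L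
      · rw [indicator_of_mem h1, indicator_of_mem h2, indicator_of_mem (mk_mem_prod h1 h2)]
        ring
      · rw [indicator_of_notMem h2,
          indicator_of_notMem (show z ∉ box L ×ˢ box L from fun h => h2 h.2)]
        ring
    · rw [indicator_of_notMem h1,
        indicator_of_notMem (show z ∉ box L ×ˢ box L from fun h => h1 h.1)]
      ring
  -- the Coulomb kernel is integrable on `Λ × Λ`
  have hinner : ∀ x : Space, ∫⁻ y in box L, ENNReal.ofReal ((4 * π * ‖x - y‖)⁻¹) =
      ENNReal.ofReal ((4 * π)⁻¹ * backgroundPotential L x) := by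
    intro x
    have e : ∀ y : Space, ENNReal.ofReal ((4 * π * ‖x - y‖)⁻¹) =
        ENNReal.ofReal ((4 * π)⁻¹) * ENNReal.ofReal (‖x - y‖⁻¹) := by
      intro y
      rw [mul_inv, ENNReal.ofReal_mul (inv_nonneg.2 (by positivity))]
    simp_rw [e]
    rw [lintegral_const_mul' _ _ ENNReal.ofReal_ne_top,
      ← ofReal_integral_eq_lintegral_ofReal (integrableOn_inv_norm_sub_box x L)
        (Eventually.of_forall fun y => inv_nonneg.2 (norm_nonneg _)),
      ← ENNReal.ofReal_mul (inv_nonneg.2 (by positivity)), backgroundPotential]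
  have hKint : IntegrableOn (fun z : Space × Space => (4 * π * ‖z.1 - z.2‖)⁻¹) (box L ×ˢ box L)
      (volume.prod volume) := by
    refine ⟨hKm.aestronglyMeasurable, (hasFiniteIntegral_iff_ofReal
      (Eventually.of_forall fun z => inv_nonneg.2 (by positivity))).2 ?_⟩
    rw [← Measure.prod_restrict, lintegral_prod _ hKm.ennreal_ofReal.aemeasurable]
    calc ∫⁻ x in box L, ∫⁻ y in box L, ENNReal.ofReal ((4 * π * ‖x - y‖)⁻¹)
        = ∫⁻ x in box L, ENNReal.ofReal ((4 * π)⁻¹ * backgroundPotential L x) :=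
          setLIntegral_congr_fun (measurableSet_box L) fun x _ => hinner x
      _ ≤ ∫⁻ _ in box L, ENNReal.ofReal ((4 * π)⁻¹ * (6 * π * L ^ 2)) :=
          setLIntegral_mono' (measurableSet_box L) fun x hx => ENNReal.ofReal_le_ofReal
            (mul_le_mul_of_nonneg_left (backgroundPotential_le hx) (inv_nonneg.2 (by positivity)))
      _ < ⊤ := by
          rw [setLIntegral_const]
          exact ENNReal.mul_lt_top ENNReal.ofReal_lt_top (volume_box_lt_top L)
  refine ⟨?_, ?_⟩
  · rw [hF, integrable_indicator_iff hs]
    exact hKint.const_mul _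
  · have hKint' : Integrable (fun z : Space × Space => (4 * π * ‖z.1 - z.2‖)⁻¹)
        ((volume.restrict (box L)).prod (volume.restrict (box L))) := by
      rw [Measure.prod_restrict]
      exact hKint
    rw [hF, integral_indicator hs, ← Measure.prod_restrict, integral_const_mul,
      integral_prod _ hKint']
    have hx : ∀ x : Space, ∫ y in box L, (4 * π * ‖x - y‖)⁻¹ = (4 * π)⁻¹ * backgroundPotential L x := by
      intro x
      simp_rw [mul_inv]
      rw [integral_const_mul, backgroundPotential]
    simp_rw [hx]
    rw [integral_const_mul, backgroundSelfEnergy]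
    ring

/-! ### The jellium Coulomb energy is bounded below -/

/-- **Jellium lower bound with Gaussian clouds, free parameter**: for distinct `x₁, …, x_N ∈ ℝ³`,
a box `Λ_L`, background density `ρ̄ ≥ 0` and every `t > 0`,
`-N (4πρ̄t + (2√(2πt))⁻¹) ≤ ∑_{i<j} |xᵢ - xⱼ|⁻¹ - ρ̄ ∑ᵢ V₁(xᵢ) + backgroundSelfEnergy ρ̄ L`
(`V₁ = backgroundPotential L`, `backgroundSelfEnergy = ½ρ̄²∬_{Λ×Λ}|x-y|⁻¹`): Onsager's lemma
(`Coulomb.onsager_lemma`) for the background `ρ̄𝟙_Λ`, the defect bound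
`sum_integral_coulomb_le_cloud_add`, and multiplication by `4π`. [cite: LiebSeiringer2009, §14.7] -/
theorem coulombEnergy_ge_of_clouds {N : ℕ} {X : Fin N → Space} (hX : Function.Injective X)
    {ρbar : ℝ} (hρ : 0 ≤ ρbar) (L : ℝ) {t : ℝ} (ht : 0 < t) :
    -(N * (4 * π * ρbar * t + 1 / (2 * Real.sqrt (2 * π * t)))) ≤
      (∑ i, ∑ j with i < j, ‖X i - X j‖⁻¹) - ρbar * ∑ i, backgroundPotential L (X i) +
        backgroundSelfEnergy ρbar L := by
  have hm := measurable_boxBackground ρbar L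
  have hi := integrable_boxBackground ρbar L
  obtain ⟨hρρ, hD⟩ := integral_prod_boxBackground_coulomb ρbar L
  have h0 : ∀ y, 0 ≤ (box L).indicator (fun _ : Space => ρbar) y := fun y => by
    by_cases hy : y ∈ box L
    · rw [indicator_of_mem hy]; exact hρ
    · rw [indicator_of_notMem hy]
  have h1 : ∀ y, (box L).indicator (fun _ : Space => ρbar) y ≤ ρbar := fun y => by
    by_cases hy : y ∈ box L
    · rw [indicator_of_mem hy]
    · rw [indicator_of_notMem hy]; exact hρ
  have hO := onsager_lemma hX ht hm hi hρρ
  have hB := sum_integral_coulomb_le_cloud_add X ht hm hi h0 h1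
  have hP : ∑ i, ∫ y, (box L).indicator (fun _ : Space => ρbar) y * (4 * π * ‖X i - y‖)⁻¹ =
      (4 * π)⁻¹ * (ρbar * ∑ i, backgroundPotential L (X i)) := by
    rw [Finset.mul_sum, Finset.mul_sum]
    exact Finset.sum_congr rfl fun i _ => by rw [integral_boxBackground_mul_coulomb]; ring
  have hpairs : ∑ i, ∑ j with i < j, (4 * π * ‖X i - X j‖)⁻¹ =
      (4 * π)⁻¹ * ∑ i, ∑ j with i < j, ‖X i - X j‖⁻¹ := by
    rw [Finset.mul_sum]
    refine Finset.sum_congr rfl fun i _ => ?_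
    rw [Finset.mul_sum]
    refine Finset.sum_congr rfl fun j _ => ?_
    rw [mul_inv]
  rw [hD, hpairs] at hO
  rw [hP] at hB
  have hsq : 0 < Real.sqrt (2 * π * t) := Real.sqrt_pos.2 (by positivity)
  have key : 0 ≤ (4 * π)⁻¹ * (∑ i, ∑ j with i < j, ‖X i - X j‖⁻¹) -
      (4 * π)⁻¹ * (ρbar * ∑ i, backgroundPotential L (X i)) +
      (4 * π)⁻¹ * backgroundSelfEnergy ρbar L + N * (ρbar * t) +
      N / (8 * π * Real.sqrt (2 * π * t)) := by
    linarith
  have h4 : (4 * π) * (4 * π)⁻¹ = 1 := mul_inv_cancel₀ (by positivity)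
  have h5 : (4 * π) * (N / (8 * π * Real.sqrt (2 * π * t))) =
      N * (1 / (2 * Real.sqrt (2 * π * t))) := by
    have hπ : (π : ℝ) ≠ 0 := Real.pi_ne_zero
    have hs : Real.sqrt (2 * π * t) ≠ 0 := hsq.ne'
    field_simp
    ring
  have hexp : (4 * π) * ((4 * π)⁻¹ * (∑ i, ∑ j with i < j, ‖X i - X j‖⁻¹) -
      (4 * π)⁻¹ * (ρbar * ∑ i, backgroundPotential L (X i)) +
      (4 * π)⁻¹ * backgroundSelfEnergy ρbar L + N * (ρbar * t) +
      N / (8 * π * Real.sqrt (2 * π * t))) =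
      (∑ i, ∑ j with i < j, ‖X i - X j‖⁻¹) - ρbar * ∑ i, backgroundPotential L (X i) +
        backgroundSelfEnergy ρbar L + N * (4 * π * ρbar * t + 1 / (2 * Real.sqrt (2 * π * t))) := by
    calc (4 * π) * ((4 * π)⁻¹ * (∑ i, ∑ j with i < j, ‖X i - X j‖⁻¹) -
          (4 * π)⁻¹ * (ρbar * ∑ i, backgroundPotential L (X i)) +
          (4 * π)⁻¹ * backgroundSelfEnergy ρbar L + N * (ρbar * t) +
          N / (8 * π * Real.sqrt (2 * π * t)))
        = ((4 * π) * (4 * π)⁻¹) * (∑ i, ∑ j with i < j, ‖X i - X j‖⁻¹) -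
          ((4 * π) * (4 * π)⁻¹) * (ρbar * ∑ i, backgroundPotential L (X i)) +
          ((4 * π) * (4 * π)⁻¹) * backgroundSelfEnergy ρbar L + N * (4 * π * ρbar * t) +
          (4 * π) * (N / (8 * π * Real.sqrt (2 * π * t))) := by ring
      _ = _ := by rw [h4, h5]; ring
  have hmul := mul_nonneg (by positivity : (0 : ℝ) ≤ 4 * π) key
  rw [hexp] at hmul
  linarith

/-- **The Onsager–Lieb–Narnhofer bound `U ≥ -(3/2) N ρ̄^{1/3}`**: for distinct
`x₁, …, x_N ∈ ℝ³`, a box `Λ_L` and background density `ρ̄ ≥ 0`,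
`-(3/2) N ρ̄^{1/3} ≤ ∑_{i<j} |xᵢ - xⱼ|⁻¹ - ρ̄ ∑ᵢ ∫_Λ |xᵢ - y|⁻¹ dy + ½ρ̄² ∬_{Λ×Λ} |x - y|⁻¹`
(`coulombEnergy_ge_of_clouds` at the optimal `t = (8π ρ̄^{2/3})⁻¹`, where
`4πρ̄t = ½ρ̄^{1/3}` and `(2√(2πt))⁻¹ = ρ̄^{1/3}`). Gaussian clouds give the constant `3/2`;
uniformly charged balls give `0.9 (4π/3)^{1/3} ≈ 1.45` [LiebNarnhofer1975].
[cite: LiebSeiringer2009, §14.7] -/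
theorem coulombEnergy_ge {N : ℕ} {X : Fin N → Space} (hX : Function.Injective X) {ρbar : ℝ}
    (hρ : 0 ≤ ρbar) (L : ℝ) :
    -(3 / 2 * N * ρbar ^ (1 / 3 : ℝ)) ≤
      (∑ i, ∑ j with i < j, ‖X i - X j‖⁻¹) - ρbar * ∑ i, backgroundPotential L (X i) +
        backgroundSelfEnergy ρbar L := by
  have hpairs : 0 ≤ ∑ i, ∑ j with i < j, ‖X i - X j‖⁻¹ :=
    Finset.sum_nonneg fun i _ => Finset.sum_nonneg fun j _ => inv_nonneg.2 (norm_nonneg _)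
  rcases hρ.eq_or_lt with h | h
  · rw [← h, Real.zero_rpow (by norm_num)]
    simpa [backgroundSelfEnergy] using hpairs
  · set a : ℝ := ρbar ^ (1 / 3 : ℝ) with ha
    have ha0 : 0 < a := Real.rpow_pos_of_pos h _
    have ha3 : a ^ 3 = ρbar := by
      rw [ha, ← Real.rpow_natCast, ← Real.rpow_mul h.le]
      norm_num
    have ht : 0 < 1 / (8 * π * a ^ 2) := by positivity
    have hmain := coulombEnergy_ge_of_clouds hX hρ L ht
    have e1 : 4 * π * ρbar * (1 / (8 * π * a ^ 2)) = a / 2 := by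
      rw [← ha3]
      field_simp
      ring
    have e2 : Real.sqrt (2 * π * (1 / (8 * π * a ^ 2))) = 1 / (2 * a) := by
      rw [show 2 * π * (1 / (8 * π * a ^ 2)) = (1 / (2 * a)) ^ 2 by field_simp; ring]
      exact Real.sqrt_sq (by positivity)
    have e3 : 1 / (2 * (1 / (2 * a))) = a := by
      field_simp
    rw [e1, e2, e3] at hmain
    linarith

/-! ### Consequences for the charged Bose gas functional -/

/-- On the box, off the (null) coincidence set, the tree's `ℝ≥0∞` jellium energy is bounded below:
`ofReal (jelliumEnergyShift 1 ρ̄ N L - (3/2) N ρ̄^{1/3}) ≤ jelliumInteraction ρ̄ N L X`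
(`jelliumInteraction = U + jelliumEnergyShift 1` on `Λ^N`, `JelliumBoseGas.shiftedCoulomb_eq`).
[cite: LSSY2005, Ch. 10 (10.1)] -/
theorem jelliumInteraction_ge {N : ℕ} {L ρbar : ℝ} (hρ : 0 ≤ ρbar) {X : Config N}
    (hXb : X ∈ boxN N L) (hX : Function.Injective X) :
    ENNReal.ofReal (jelliumEnergyShift 1 ρbar N L - 3 / 2 * N * ρbar ^ (1 / 3 : ℝ)) ≤
      jelliumInteraction ρbar N L X := by
  rw [jelliumInteraction_eq_ofReal hρ hXb, shiftedCoulomb_eq]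
  refine ENNReal.ofReal_le_ofReal ?_
  have h := coulombEnergy_ge hX hρ L
  linarith

/-- For every trial state, `∫ jelliumInteraction · |Ψ|² ≥ jelliumEnergyShift 1 ρ̄ N L - (3/2) N ρ̄^{1/3}`
(in `ℝ≥0∞`, via `ofReal`): `Ψ` lives on `Λ^N`, coincidences are null, `‖Ψ‖₂ = 1`.
[cite: LSSY2005, Ch. 10 (10.1)] -/
theorem lintegral_jelliumInteraction_ge {N : ℕ} {L ρbar : ℝ} (hρ : 0 ≤ ρbar) (Ψ : TrialState N L) :
    ENNReal.ofReal (jelliumEnergyShift 1 ρbar N L - 3 / 2 * N * ρbar ^ (1 / 3 : ℝ)) ≤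
      ∫⁻ X, jelliumInteraction ρbar N L X * (‖Ψ.ψ X‖₊ : ℝ≥0∞) ^ 2 := by
  set c : ℝ≥0∞ := ENNReal.ofReal (jelliumEnergyShift 1 ρbar N L - 3 / 2 * N * ρbar ^ (1 / 3 : ℝ))
    with hc
  calc c = c * ∫⁻ X, (‖Ψ.ψ X‖₊ : ℝ≥0∞) ^ 2 := by rw [Ψ.norm_eq, mul_one]
    _ = ∫⁻ X, c * (‖Ψ.ψ X‖₊ : ℝ≥0∞) ^ 2 := (lintegral_const_mul' c _ ENNReal.ofReal_ne_top).symm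
    _ ≤ ∫⁻ X, jelliumInteraction ρbar N L X * (‖Ψ.ψ X‖₊ : ℝ≥0∞) ^ 2 := by
        refine lintegral_mono_ae ?_
        filter_upwards [ae_injective N] with X hX
        by_cases hb : X ∈ boxN N L
        · exact mul_le_mul' (jelliumInteraction_ge hρ hb hX) le_rfl
        · rw [Ψ.eq_zero X hb]
          simp

/-- **A priori bound for the charged gas functional**: for every repulsive core `v`, coupling
`q ≥ 0`, background density `ρ̄ ≥ 0` and trial state `Ψ`,
`ofReal (jelliumEnergyShift q ρ̄ N L - (3/2) q N ρ̄^{1/3}) ≤ chargedEnergy v q ρ̄ Ψ`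
(the kinetic and core energies are dropped). [cite: LiebSolovej2001, p. 5] -/
theorem chargedEnergy_ge {N : ℕ} {L : ℝ} (v : ℝ → ℝ≥0∞) {q ρbar : ℝ} (hq : 0 ≤ q) (hρ : 0 ≤ ρbar)
    (Ψ : TrialState N L) :
    ENNReal.ofReal (jelliumEnergyShift q ρbar N L - 3 / 2 * q * N * ρbar ^ (1 / 3 : ℝ)) ≤
      chargedEnergy v q ρbar Ψ := by
  have hshift : jelliumEnergyShift q ρbar N L - 3 / 2 * q * N * ρbar ^ (1 / 3 : ℝ) =
      q * (jelliumEnergyShift 1 ρbar N L - 3 / 2 * N * ρbar ^ (1 / 3 : ℝ)) := by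
    simp only [jelliumEnergyShift]
    ring
  rw [hshift, ENNReal.ofReal_mul hq]
  exact (mul_le_mul' le_rfl (lintegral_jelliumInteraction_ge hρ Ψ)).trans le_add_self

/-- The same bound for the charged ground-state energy. [cite: LiebSolovej2001, p. 5] -/
theorem chargedGroundStateEnergy_ge (v : ℝ → ℝ≥0∞) {q ρbar : ℝ} (hq : 0 ≤ q) (hρ : 0 ≤ ρbar)
    (N : ℕ) (L : ℝ) :
    ENNReal.ofReal (jelliumEnergyShift q ρbar N L - 3 / 2 * q * N * ρbar ^ (1 / 3 : ℝ)) ≤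
      chargedGroundStateEnergy v q ρbar N L :=
  le_iInf fun Ψ => chargedEnergy_ge v hq hρ Ψ

/-- **The Onsager–Lieb–Narnhofer a priori bound in the normalisation of `foldyLaw`**: for
`N ≥ 1`, `L > 0`, `q ≥ 0`, `ρ̄ ≥ 0`, the neutral-jellium ground-state energy per particle
`E₀(N, L)/N = (chargedGroundStateEnergy 0 q ρ̄ N L - jelliumEnergyShift q ρ̄ N L)/N` satisfies
`E₀(N, L)/N ≥ -(3/2) q ρ̄^{1/3}` ("the potential energy alone is bounded below by
`e₀ ∼ -ρ^{1/3}`", Onsager's argument). [cite: LiebSolovej2001, p. 5] -/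
theorem groundStateEnergy_per_particle_ge {N : ℕ} (hN : 0 < N) {L : ℝ} (hL : 0 < L) {q ρbar : ℝ}
    (hq : 0 ≤ q) (hρ : 0 ≤ ρbar) :
    -(3 / 2 * q * ρbar ^ (1 / 3 : ℝ)) ≤
      ((chargedGroundStateEnergy 0 q ρbar N L).toReal - jelliumEnergyShift q ρbar N L) / N := by
  have hfin := chargedGroundStateEnergy_ne_top hN hL q hρ
  have h := (ENNReal.ofReal_le_iff_le_toReal hfin).1 (chargedGroundStateEnergy_ge 0 hq hρ N L)
  have hN' : (0 : ℝ) < N := by exact_mod_cast hN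
  rw [le_div_iff₀ hN']
  linarith

/-- The a priori bound along the thermodynamic-limit sequence of `foldyLaw` (`L = (N/ρ)^{1/3}`):
for `ρ > 0`, `q ≥ 0` and every `N ≥ 1`, `E₀(N, (N/ρ)^{1/3})/N ≥ -(3/2) q ρ^{1/3}` — an
`N`-uniform lower bound of order `ρ^{1/3}`, against Foldy's `-foldyConstant q^{5/4} ρ^{1/4}`.
[cite: LiebSolovej2001, p. 5] -/
theorem groundStateEnergy_per_particle_ge_sideLength {ρ : ℝ} (hρ : 0 < ρ) {q : ℝ} (hq : 0 ≤ q)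
    {N : ℕ} (hN : 0 < N) :
    -(3 / 2 * q * ρ ^ (1 / 3 : ℝ)) ≤
      ((chargedGroundStateEnergy 0 q ρ N (sideLength ρ N)).toReal -
          jelliumEnergyShift q ρ N (sideLength ρ N)) / N :=
  groundStateEnergy_per_particle_ge hN
    (Real.rpow_pos_of_pos (div_pos (Nat.cast_pos.2 hN) hρ) _) hq hρ.le

end Literature.MathematicalPhysics.QuantumManyBody.JelliumBoseGas
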